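import Literature.Probability.RandomPlanarGeometry.SAWPolygonSurgery
import HarnessLib

/-!
# Surgery on self-avoiding polygons along sub-paths: opening a polygon along a path, rerouting a
# sub-path, merging two polygons after deleting a sub-path from each

Topic `Literature/Probability/RandomPlanarGeometry` (continues `SAWPolygonSurgery.lean`:
`IsPolygon.exists_isPath_erase` — opening a polygon at ONE edge — and `IsPolygon.merge` — merging two
vertex-disjoint polygons after deleting ONE edge from each; here the deleted edge becomes a deleted
SUB-PATH).  Lane «pcv-sawmu» (a-p4 g13): these are the lattice-free lemmas behind the capless junctions of
Madras' join on the honeycomb lattice (LINE «HEX-MADRAS»: the joined polygon is `(P ∪ Q′) △ ∂C` for a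
cluster `C` of one or two lattice faces meeting `P` and `Q′` in contiguous paths — A. Hammond,
arXiv:1504.05286v5, Definition 4.3 p. 20, "`J(τ,σ) = (τ_mod ∪ (σ_mod + T₂e₁)) Δ P¹`", the junction plaquette;
N. Madras, J. Stat. Phys. 78 (1995) §2), phrased for Mathlib's `SimpleGraph.Walk` and the tree's
`IsPolygon G E` (the edge set of a cycle, `SupercriticalSAWPolygons.lean`).

* `IsPolygon.exists_isPath_sdiff` — **opening a polygon along a sub-path**: if the edges of a
  self-avoiding path `p : a ⇝ b` of positive length `< #E` lie in the polygon `E`, there is a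
  self-avoiding path `a ⇝ b` with edge set `E ∖ edges(p)`, of length `#E − |p|`, whose vertices are the
  vertices of `E` off the interior of `p`;
* `IsPolygon.reroute` — **rerouting**: replacing such a sub-path by a self-avoiding path `R : a ⇝ b` of
  length `≥ 2` whose interior avoids the vertices of `E` gives a polygon with `#E − |p| + |R|` edges;
* `IsPolygon.merge_paths` — **merging two vertex-disjoint polygons along two connecting paths after
  deleting a sub-path from each**: `E₁ ⊇ edges(p₁ : a ⇝ b)`, `E₂ ⊇ edges(p₂ : c ⇝ d)`, connecting paths
  `R₁ : a ⇝ c`, `R₂ : b ⇝ d`, vertex-disjoint and meeting the vertices of `E₁` (resp. `E₂`) only in their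
  endpoints; the result `(E₁ ∖ p₁) ∪ (E₂ ∖ p₂) ∪ R₁ ∪ R₂` is a polygon with
  `#E₁ + #E₂ − |p₁| − |p₂| + |R₁| + |R₂|` edges (`IsPolygon.merge` is the case `|p₁| = |p₂| = 1`).

Editions: ed.1 9d793a941328222f; ed.2 = ed.1 with the plumbing lemma `ne_of_isPath_of_length_pos` made `private`
(lit-1 g18 PRE-FILING catch PS-1).  Everything here is [folklore] (elementary walk surgery); the cited locator is the use made of it.
Mathlib: `IsPath.isCycle_append`, `Walk.fst_mem_support_of_mem_edges`, `Zd.isPath_append_of_inter`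
(`BDGS2012Proofs.lean`).

Consumers (lane «pcv-sawmu», LINE «HEX-MADRAS»): `HexSAWPolygonJunctions.lean` (the five capless junctions are instances of
`IsPolygon.merge_paths`), `HexSAWPolygonJunctionUniqueT3/T5.lean` (`IsPolygon.exists_isPath_sdiff` opens a polygon along the two-step arc through a
dropped corner).  ed.3 (a-p4 g14) = ed.2 + this paragraph (no code change).
-/

noncomputable section

open SimpleGraph

namespace Literature.Probability.RandomPlanarGeometry.SAW

section Generic

variable {V : Type*} {G : SimpleGraph V} [DecidableEq V]

/-! ### Opening a polygon along a sub-path -/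

omit [DecidableEq V] in
/-- A self-avoiding path of positive length has distinct endpoints (private plumbing). [folklore] -/
private theorem ne_of_isPath_of_length_pos {a b : V} {p : G.Walk a b} (hp : p.IsPath) (h0 : 0 < p.length) :
    a ≠ b := by
  rintro rfl
  have hn : p.Nil := Walk.isPath_iff_nil.1 hp
  rw [← Walk.length_eq_zero_iff] at hn
  omega

/-- **Opening a polygon along a sub-path.** If the edges of a self-avoiding path `p : a ⇝ b` of positive
length `< #E` all belong to a polygon `E`, there is a self-avoiding path from `a` to `b` with edge set
`E ∖ edges(p)`, of length `#E − |p|`, whose vertices are exactly the vertices of `E` that are not interior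
vertices of `p`. [cite: Hammond2015SAPJoining, Definition 4.3 p. 20 (arXiv v5: the junction plaquette surgery); folklore] -/
theorem IsPolygon.exists_isPath_sdiff {E : Finset (Sym2 V)} (hE : IsPolygon G E) :
    ∀ {a b : V} (p : G.Walk a b), p.IsPath → (∀ e ∈ p.edges, e ∈ E) → 0 < p.length →
      p.length < E.card →
      ∃ q : G.Walk a b, q.IsPath ∧ q.edges.toFinset = E \ p.edges.toFinset ∧
        q.length + p.length = E.card ∧
        ∀ x, x ∈ q.support ↔ (∃ e ∈ E, x ∈ e) ∧ (x ∈ p.support → x = a ∨ x = b) := by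
  intro a b p
  induction p with
  | nil => intro _ _ h0; simp at h0
  | cons h p' ih =>
    rename_i a a' b
    intro hp hpE _ hlt
    have haa' : s(a, a') ∈ E := hpE _ (by simp [Walk.edges_cons])
    have hp' : p'.IsPath := hp.of_cons
    have ha_notin : a ∉ p'.support := ((Walk.cons_isPath_iff h p').1 hp).2
    cases p' with
    | nil =>
      -- a single edge: open the polygon at it
      obtain ⟨P, hP, hPe, hPab, hPl, hPs⟩ := hE.exists_isPath_erase haa'
      refine ⟨P, hP, ?_, ?_, fun x => ?_⟩
      · rw [hPe, Walk.edges_cons, Walk.edges_nil, List.toFinset_cons, List.toFinset_nil,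
          insert_empty_eq, Finset.sdiff_singleton_eq_erase]
      · simp only [Walk.length_cons, Walk.length_nil]
        omega
      · rw [hPs]
        simp
    | cons h' p'' =>
      rename_i a'' 
      have hlen : (Walk.cons h' p'').length + 1 = (Walk.cons h (Walk.cons h' p'')).length := by
        simp [Walk.length_cons]
      have hsub : ∀ e ∈ (Walk.cons h' p'').edges, e ∈ E := fun e he =>
        hpE e (by rw [Walk.edges_cons h]; exact List.mem_cons_of_mem _ he)
      have hlt' : (Walk.cons h' p'').length < E.card := by simp [Walk.length_cons] at hlt ⊢; omega
      obtain ⟨r, hr, hre, hrl, hrs⟩ := ih hp' hsub (by simp) hlt'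
      -- the edge `aa'` is an edge of `r` at its start `a'`
      have hmem : s(a', a) ∈ r.edges := by
        rw [← List.mem_toFinset, hre, Finset.mem_sdiff, Sym2.eq_swap]
        refine ⟨haa', fun hh => ha_notin ?_⟩
        exact Walk.fst_mem_support_of_mem_edges _ (List.mem_toFinset.1 hh)
      cases r with
      | nil => simp at hmem
      | cons hadj r'' =>
        rename_i x
        have ha'_notin : a' ∉ r''.support := ((Walk.cons_isPath_iff hadj r'').1 hr).2
        rw [Walk.edges_cons, List.mem_cons] at hmem
        have hxa : x = a := by
          rcases hmem with hmem | hmem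
          · rcases Sym2.eq_iff.1 hmem with ⟨-, h2⟩ | ⟨h1, -⟩
            · exact h2.symm
            · exact absurd h1 hadj.ne
          · exact absurd (Walk.fst_mem_support_of_mem_edges _ hmem) ha'_notin
        subst hxa
        refine ⟨r'', hr.of_cons, ?_, ?_, fun y => ?_⟩
        · -- edges
          have hcons : (Walk.cons hadj r'').edges.toFinset = insert s(a', x) r''.edges.toFinset := by
            rw [Walk.edges_cons, List.toFinset_cons]
          have hnot : s(a', x) ∉ r''.edges.toFinset := fun hh =>
            ha'_notin (Walk.fst_mem_support_of_mem_edges _ (List.mem_toFinset.1 hh))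
          calc r''.edges.toFinset = (insert s(a', x) r''.edges.toFinset).erase s(a', x) := by
                rw [Finset.erase_insert hnot]
            _ = (E \ (Walk.cons h' p'').edges.toFinset).erase s(a', x) := by rw [← hcons, hre]
            _ = E \ (Walk.cons h (Walk.cons h' p'')).edges.toFinset := by
                rw [Walk.edges_cons h, List.toFinset_cons, Finset.sdiff_insert, Sym2.eq_swap]
        · simp only [Walk.length_cons] at hrl ⊢
          omega
        · -- support
          have hsupp : y ∈ r''.support ↔ y ∈ (Walk.cons hadj r'').support ∧ y ≠ a' := by
            rw [Walk.support_cons, List.mem_cons]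
            constructor
            · intro hy
              exact ⟨Or.inr hy, fun hya => ha'_notin (hya ▸ hy)⟩
            · rintro ⟨hy | hy, hne⟩
              · exact absurd hy hne
              · exact hy
          rw [hsupp, hrs]
          have hab : a' ≠ b := ne_of_isPath_of_length_pos hp' (by simp)
          constructor
          · rintro ⟨⟨hyE, hyp⟩, hya⟩
            refine ⟨hyE, fun hy => ?_⟩
            rw [Walk.support_cons, List.mem_cons] at hy
            rcases hy with hy | hy
            · exact Or.inl hy
            · rcases hyp hy with hy' | hy'
              · exact absurd hy' hya
              · exact Or.inr hy'
          · rintro ⟨hyE, hyp⟩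
            refine ⟨⟨hyE, fun hy => ?_⟩, fun hya => ?_⟩
            · rcases hyp (by rw [Walk.support_cons]; exact List.mem_cons_of_mem _ hy) with hy' | hy'
              · exact absurd (hy' ▸ hy) ha_notin
              · exact Or.inr hy'
            · subst hya
              rcases hyp (by rw [Walk.support_cons, Walk.support_cons]; simp) with hy' | hy'
              · exact hadj.ne hy'
              · exact hab hy'

/-! ### Rerouting a sub-path -/

/-- **Rerouting a sub-path of a polygon.** Let the edges of a self-avoiding path `p : a ⇝ b` of positive
length `< #E` lie in the polygon `E`, and let `R : a ⇝ b` be a self-avoiding path of length `≥ 2` whose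
vertices other than `a`, `b` are not vertices of `E`.  Then `(E ∖ edges(p)) ∪ edges(R)` is a polygon with
`#E − |p| + |R|` edges (on a lattice: `P △ ∂B` for a face `B` meeting the polygon `P` in the contiguous
path `p`, `R` being the complementary arc of `∂B`). [cite: Hammond2015SAPJoining, Definition 4.3 p. 20 (arXiv v5: "τ_mod", the locally modified polygon); folklore] -/
theorem IsPolygon.reroute {E : Finset (Sym2 V)} (hE : IsPolygon G E) {a b : V} {p : G.Walk a b}
    (hp : p.IsPath) (hpE : ∀ e ∈ p.edges, e ∈ E) (h0 : 0 < p.length) (hlt : p.length < E.card)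
    {R : G.Walk a b} (hR : R.IsPath) (h2 : 2 ≤ R.length)
    (hRE : ∀ x ∈ R.support, (∃ e ∈ E, x ∈ e) → x = a ∨ x = b) :
    IsPolygon G (E \ p.edges.toFinset ∪ R.edges.toFinset) ∧
      (E \ p.edges.toFinset ∪ R.edges.toFinset).card + p.length = E.card + R.length := by
  obtain ⟨q, hq, hqe, hql, hqs⟩ := hE.exists_isPath_sdiff p hp hpE h0 hlt
  -- the closed walk `q ++ R⁻¹` is a cycle
  have hcyc : (q.append R.reverse).IsCycle := by
    refine hq.isCycle_append hR.reverse ?_ (Or.inr (by rw [Walk.length_reverse]; omega))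
    intro x hx hx'
    have hxq : x ∈ q.support := List.mem_of_mem_tail hx
    have hxR : x ∈ R.support := by
      have := List.mem_of_mem_tail hx'
      rwa [Walk.support_reverse, List.mem_reverse] at this
    have hxa : x ≠ a := by
      rintro rfl
      have hnd := (Walk.isPath_def _).1 hq
      rw [← Walk.cons_tail_support] at hnd
      exact (List.nodup_cons.1 hnd).1 hx
    have hxb : x ≠ b := by
      rintro rfl
      have hnd := (Walk.isPath_def _).1 hR.reverse
      rw [← Walk.cons_tail_support] at hnd
      exact (List.nodup_cons.1 hnd).1 hx'
    rcases hRE x hxR ((hqs x).1 hxq).1 with h | h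
    · exact hxa h
    · exact hxb h
  have hedges : (q.append R.reverse).edges.toFinset = E \ p.edges.toFinset ∪ R.edges.toFinset := by
    rw [Walk.edges_append, Walk.edges_reverse, List.toFinset_append, List.toFinset_reverse, hqe]
  refine ⟨⟨a, _, hcyc, hedges⟩, ?_⟩
  rw [← hedges, List.toFinset_card_of_nodup hcyc.edges_nodup, Walk.length_edges, Walk.length_append,
    Walk.length_reverse]
  omega

/-! ### Merging two polygons along two connecting paths, deleting a sub-path from each -/

/-- **Merging two polygons after deleting a sub-path from each.** Let `E₁`, `E₂` be vertex-disjoint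
polygons, `p₁ : a ⇝ b` and `p₂ : c ⇝ d` self-avoiding paths of positive length whose edges lie in `E₁`,
`E₂` respectively (proper: `|pᵢ| < #Eᵢ`), and `R₁ : a ⇝ c`, `R₂ : b ⇝ d` vertex-disjoint self-avoiding
paths meeting the vertices of `E₁` only in `a` (resp. `b`) and those of `E₂` only in `c` (resp. `d`).
Then `(E₁ ∖ p₁) ∪ (E₂ ∖ p₂) ∪ R₁ ∪ R₂` is a polygon with `#E₁ + #E₂ − |p₁| − |p₂| + |R₁| + |R₂|` edges —
on a lattice: `(P ∪ Q′) △ ∂C` for a face cluster `C` meeting `P` and `Q′` in the contiguous paths `p₁`,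
`p₂`, the connecting paths being the two complementary arcs of `∂C` ("`J(τ,σ) = (τ_mod ∪ (σ_mod + T₂e₁)) Δ P¹`").
[cite: Hammond2015SAPJoining, Definition 4.3 p. 20 (arXiv v5: the junction plaquette); folklore] -/
theorem IsPolygon.merge_paths {E₁ E₂ : Finset (Sym2 V)} (h₁ : IsPolygon G E₁) (h₂ : IsPolygon G E₂)
    {a b c d : V} {p₁ : G.Walk a b} {p₂ : G.Walk c d}
    (hp₁ : p₁.IsPath) (hp₁E : ∀ e ∈ p₁.edges, e ∈ E₁) (h0₁ : 0 < p₁.length) (hlt₁ : p₁.length < E₁.card)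
    (hp₂ : p₂.IsPath) (hp₂E : ∀ e ∈ p₂.edges, e ∈ E₂) (h0₂ : 0 < p₂.length) (hlt₂ : p₂.length < E₂.card)
    {R₁ : G.Walk a c} {R₂ : G.Walk b d} (hR₁ : R₁.IsPath) (hR₂ : R₂.IsPath)
    (hE : ∀ x, (∃ e ∈ E₁, x ∈ e) → (∃ e ∈ E₂, x ∈ e) → False)
    (hR₁E₁ : ∀ x ∈ R₁.support, (∃ e ∈ E₁, x ∈ e) → x = a)
    (hR₁E₂ : ∀ x ∈ R₁.support, (∃ e ∈ E₂, x ∈ e) → x = c)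
    (hR₂E₁ : ∀ x ∈ R₂.support, (∃ e ∈ E₁, x ∈ e) → x = b)
    (hR₂E₂ : ∀ x ∈ R₂.support, (∃ e ∈ E₂, x ∈ e) → x = d)
    (hR : ∀ x ∈ R₁.support, x ∉ R₂.support) :
    IsPolygon G (E₁ \ p₁.edges.toFinset ∪ E₂ \ p₂.edges.toFinset ∪ (R₁.edges.toFinset ∪ R₂.edges.toFinset)) ∧
      (E₁ \ p₁.edges.toFinset ∪ E₂ \ p₂.edges.toFinset ∪ (R₁.edges.toFinset ∪ R₂.edges.toFinset)).card +
          p₁.length + p₂.length = E₁.card + E₂.card + R₁.length + R₂.length := by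
  -- open `E₁` along `p₁` (as a path `b ⇝ a`) and `E₂` along `p₂` (as a path `c ⇝ d`)
  obtain ⟨q₁, hq₁, hq₁e, hq₁l, hq₁s⟩ := h₁.exists_isPath_sdiff p₁ hp₁ hp₁E h0₁ hlt₁
  obtain ⟨P₂, hP₂, hP₂e, hP₂l, hP₂s⟩ := h₂.exists_isPath_sdiff p₂ hp₂ hp₂E h0₂ hlt₂
  set P₁ := q₁.reverse with hP₁def
  have hP₁ : P₁.IsPath := hq₁.reverse
  have hP₁s : ∀ x, x ∈ P₁.support → ∃ e ∈ E₁, x ∈ e := fun x hx => by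
    rw [hP₁def, Walk.support_reverse, List.mem_reverse] at hx
    exact ((hq₁s x).1 hx).1
  have hP₂s' : ∀ x, x ∈ P₂.support → ∃ e ∈ E₂, x ∈ e := fun x hx => ((hP₂s x).1 hx).1
  -- the long path `b ⇝ a ⇝ c ⇝ d`
  have hT₁ : (P₁.append R₁).IsPath :=
    Zd.isPath_append_of_inter hP₁ hR₁ fun x hx hx' => hR₁E₁ x hx' (hP₁s x hx)
  have hT : ((P₁.append R₁).append P₂).IsPath := by
    refine Zd.isPath_append_of_inter hT₁ hP₂ fun x hx hx' => ?_
    rw [Walk.mem_support_append_iff] at hx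
    rcases hx with hx | hx
    · exact (hE x (hP₁s x hx) (hP₂s' x hx')).elim
    · exact hR₁E₂ x hx (hP₂s' x hx')
  -- closing it with `R₂` gives a cycle
  have hcyc : (((P₁.append R₁).append P₂).append R₂.reverse).IsCycle := by
    refine hT.isCycle_append hR₂.reverse ?_ (Or.inl ?_)
    · intro x hx hx'
      have hx1 : x ∈ ((P₁.append R₁).append P₂).support := List.mem_of_mem_tail hx
      have hxR₂ : x ∈ R₂.support := by
        have := List.mem_of_mem_tail hx'
        rwa [Walk.support_reverse, List.mem_reverse] at this
      -- `x ≠ b` (tail of a path starting at `b`) and `x ≠ d` (tail of a path starting at `d`)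
      have hxb : x ≠ b := by
        rintro rfl
        have hnd := (Walk.isPath_def _).1 hT
        rw [← Walk.cons_tail_support] at hnd
        exact (List.nodup_cons.1 hnd).1 hx
      have hxd : x ≠ d := by
        rintro rfl
        have hnd := (Walk.isPath_def _).1 hR₂.reverse
        rw [← Walk.cons_tail_support] at hnd
        exact (List.nodup_cons.1 hnd).1 hx'
      rw [Walk.mem_support_append_iff, Walk.mem_support_append_iff] at hx1
      rcases hx1 with (hx1 | hx1) | hx1
      · exact hxb (hR₂E₁ x hxR₂ (hP₁s x hx1))
      · exact hR x hx1 hxR₂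
      · exact hxd (hR₂E₂ x hxR₂ (hP₂s' x hx1))
    · rw [Walk.length_append, Walk.length_append, hP₁def, Walk.length_reverse]
      -- `|q₁| = #E₁ − |p₁| ≥ 1` and `|P₂| ≥ 1`; if both are `1` … we still have `|R₁| + … `; use `#E ≥ 3`
      have h3 : 3 ≤ E₁.card := by
        obtain ⟨w, cyc, hcyc, hE₁⟩ := h₁
        have h3 := hcyc.three_le_length
        rw [← Walk.length_edges, ← List.toFinset_card_of_nodup hcyc.edges_nodup, hE₁] at h3
        exact h3
      have h3' : 3 ≤ E₂.card := by
        obtain ⟨w, cyc, hcyc, hE₂⟩ := h₂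
        have h3 := hcyc.three_le_length
        rw [← Walk.length_edges, ← List.toFinset_card_of_nodup hcyc.edges_nodup, hE₂] at h3
        exact h3
      omega
  -- its edge set and number of edges
  have hedges : (((P₁.append R₁).append P₂).append R₂.reverse).edges.toFinset =
      E₁ \ p₁.edges.toFinset ∪ E₂ \ p₂.edges.toFinset ∪ (R₁.edges.toFinset ∪ R₂.edges.toFinset) := by
    rw [Walk.edges_append, Walk.edges_append, Walk.edges_append, Walk.edges_reverse,
      Walk.edges_reverse, List.toFinset_append, List.toFinset_append, List.toFinset_append,
      List.toFinset_reverse, List.toFinset_reverse, hq₁e, hP₂e]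
    ext e
    simp only [Finset.mem_union]
    tauto
  refine ⟨⟨b, _, hcyc, hedges⟩, ?_⟩
  rw [← hedges, List.toFinset_card_of_nodup hcyc.edges_nodup, Walk.length_edges,
    Walk.length_append, Walk.length_append, Walk.length_append, Walk.length_reverse,
    Walk.length_reverse]
  omega

end Generic

end Literature.Probability.RandomPlanarGeometry.SAW

end
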